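import Literature.NumberTheory.EllipticCurves.ZpExtensionEisensteinSelmerComplexPlacesProofs
import Literature.NumberTheory.EllipticCurves.ZpExtensionEisensteinSelmerUnramifiedProofs
import Literature.NumberTheory.EllipticCurves.ZpExtensionEisensteinTwistUnramifiedTransferProofs
import Literature.NumberTheory.EllipticCurves.ZpExtensionScalarTwistFiniteProofs
import Literature.NumberTheory.GaloisRepresentations.UnramifiedSubgroupMapSurjective
import Literature.NumberTheory.GaloisRepresentations.GaloisRepUnramifiedProofs
import HarnessLib

/-!
# `cond_red` for Howard's `F_𝔮` at the finite places OUTSIDE `S ∪ {v ∣ p}` (unramified levels), and the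
# assembled clause at every place of a totally complex `K`; the curve `E[p^k]` (theorems only; no definition,
# no named fact, no instance)

Topic `NumberTheory/EllipticCurves` (D1 road of cell `pub/bsd-print-x9`; companion of
`ZpExtensionEisensteinSelmerTowerCompatProofs` (the inclusion everywhere, equality at `v ∣ p` and `v ∈ S`) and
`ZpExtensionEisensteinSelmerComplexPlacesProofs` (equality at the complex places), which left as the ONLY residual of
the hypothesis `Howard2004.DVRSetting.SatisfiesH.cond_red` for the typed Eisenstein tower
`κ.eisensteinAdicTower ρ t hm ht` (levels `T_𝔮/p^k = M_k ⊗ A_{m,k}(ψ)`) the finite places `v ∉ S`, `v ∤ p`, where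
`F_𝔮` is the plain unramified condition `H¹_ur(K_v, ·)` (`eisensteinSelmerStructure_inr_of_not_mem`).

There the equality is the surjectivity of `H¹_ur(K_v, M_{k+1} ⊗ A_{m,k+1}) → H¹_ur(K_v, M_k ⊗ A_{m,k})` along the
(surjective) reduction, for levels UNRAMIFIED at `v` — the generic
`galoisCohomology.map_localMap_unramifiedSubgroup_eq_of_surjective`
(`GaloisRepresentations/UnramifiedSubgroupMapSurjective`: `H¹(K_v^nr/K_v, X) = X/(Fr − 1)X` is right exact in `X`,
and global unramifiedness at `v` makes `I_{K_v}` act trivially).  The twist `M ⊗ A_{m,k}(ψ)` is unramified at `v ∤ p`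
as soon as `M` is (`isUnramifiedAt_eisensteinTwist_of_isUnramifiedAt`; for the curve
`WeierstrassCurve.isUnramifiedAt_eisensteinTwist_torsionGaloisModule`: good reduction, Néron–Ogg–Shafarevich).

* §1 **`map_eisensteinLocalReduce_unramifiedSubgroup_eq`** — `H¹(red_v)(H¹_ur(K_v, level k+1)) = H¹_ur(K_v, level k)`
  for the level-`k+1` twist finite and unramified at `v`.
* §2 **`map_red_eisensteinSelmerStructure_eq_inr_of_not_mem`** — `cond_red` with EQUALITY at `v ∉ S`, `v ∤ p`;
  `map_red_eisensteinSelmerStructure_eq_inr` — at every finite place;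
  **`map_red_eisensteinSelmerStructure_eq`** — at EVERY place of a totally complex `K` (e.g. imaginary quadratic):
  the clause `SatisfiesH.cond_red` verbatim for `F_𝔮` on `eisensteinAdicTower`, given the levels finite and the
  twists unramified outside `S ∪ {v ∣ p}`; `map_red_eisensteinSelmerStructure_succ_eq` — the same for the shifted
  tower `eisensteinAdicTowerSucc` (levels from `1`, D1's `DVRSetting.T`).
* §3 the curve: **`WeierstrassCurve.map_red_eisensteinSelmerStructure_torsionGaloisModule_eq`** (and `…_succ_eq`) —
  for `M_k = E[p^k]`, `S` containing the bad places away from `p`, `K` totally complex: `cond_red` at every place and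
  every level, unconditionally.

References: [Howard2004HeegnerKolyvagin] Def. 1.1.1, Def. 1.1.3, §1.6 (arXiv p. 12, L29–55), Def. 2.1.10, §2.2,
Def. 3.1.2; [MazurRubin2004] Lemma 1.1.5, Example 1.1.6; [SerreLocalFields1979] XIII §1 Prop. 1;
[SilvermanAEC2009] Prop. VII.4.1(a). BSD is not proved by any of this.
-/
noncomputable section

open scoped TensorProduct ContRepresentation
open Field IsLocalRing IsDedekindDomain
open scoped NumberField

namespace Literature.NumberTheory.EllipticCurves.ZpExtension

open Literature.NumberTheory.GaloisRepresentations
open Literature.NumberTheory.GaloisCohomology.Howard2004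

/-! ## §1 `H¹_ur` along the reduction of the Eisenstein tower at an unramified place -/

variable {K : Type} [Field K] [NumberField K] {p : ℕ} [hp : Fact p.Prime] (κ : ZpExtension K p)
  {M : ℕ → Type} [∀ k, AddCommGroup (M k)] [∀ k, TopologicalSpace (M k)] [∀ k, DiscreteTopology (M k)]
  (ρ : ∀ k, DiscreteGaloisModule K (M k))
  (t : ∀ k, (ρ (k + 1)).toContRepresentation →ⁱL (ρ k).toContRepresentation)
  {m : ℕ} (hm : 1 ≤ m) (ht : ∀ k, Function.Surjective (t k))
  (S : Finset (HeightOneSpectrum (𝓞 K)))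
  (Φ : ∀ v : HeightOneSpectrum (𝓞 K), ((p : ℕ) : 𝓞 K) ∈ v.asIdeal → OrdinaryFiltration ρ t v)

/-- **`H¹(red_v)(H¹_ur(K_v, M_{k+1} ⊗ A_{m,k+1})) = H¹_ur(K_v, M_k ⊗ A_{m,k})`** at a finite place `v` where the
(finite) level-`k+1` twist is unramified (surjective transition map `t k`; D1's `eisensteinLocalReduce`).
[cite: Howard2004HeegnerKolyvagin, Def. 1.1.3 and §1.6 (arXiv p. 12, L29–55)] [cite: MazurRubin2004, Lemma 1.1.5 and Example 1.1.6] -/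
theorem map_eisensteinLocalReduce_unramifiedSubgroup_eq (k : ℕ) [Finite (M (k + 1))]
    {v : HeightOneSpectrum (𝓞 K)} (htk : Function.Surjective (t k))
    (hur : GaloisRep.IsUnramifiedAt v (κ.eisensteinTwist (ρ (k + 1)) hm (k + 1))) :
    (DiscreteGaloisModule.unramifiedSubgroup
        (GaloisRep.toLocal v (κ.eisensteinTwist (ρ (k + 1)) hm (k + 1))) 1 :).map
        (κ.eisensteinLocalReduce ρ t hm (Sum.inr v) k) =
      (DiscreteGaloisModule.unramifiedSubgroup (GaloisRep.toLocal v (κ.eisensteinTwist (ρ k) hm k)) 1 :) := by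
  haveI := IwasawaAlgebra.EisensteinCoeff.finite_twisted (p := p) (k := k + 1) (M := M (k + 1)) hm
  exact galoisCohomology.map_localMap_unramifiedSubgroup_eq_of_surjective
    (κ.eisensteinTwist (ρ (k + 1)) hm (k + 1)) (κ.eisensteinTwist (ρ k) hm k)
    (κ.eisensteinTwistReduce hm (Nat.le_succ k) (t k)) (κ.eisensteinTwistReduce_surjective hm (Nat.le_succ k) (t k) htk)
    hur

/-! ## §2 `cond_red` for `F_𝔮` -/

/-- **`cond_red` for `F_𝔮`, EQUALITY at a finite place `v ∉ S`, `v ∤ p`** (where `F_𝔮` is the unramified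
condition), for the level-`k+1` twist finite and unramified at `v`: the reduction of the typed tower maps `F_𝔮` at
level `k + 1` ONTO `F_𝔮` at level `k`. [cite: Howard2004HeegnerKolyvagin, Def. 1.1.3, §1.6 (arXiv p. 12) and Def. 2.1.10]
[cite: MazurRubin2004, Lemma 1.1.5 and Example 1.1.6] -/
theorem map_red_eisensteinSelmerStructure_eq_inr_of_not_mem (k : ℕ) [Finite (M (k + 1))]
    {v : HeightOneSpectrum (𝓞 K)} (hv : ((p : ℕ) : 𝓞 K) ∉ v.asIdeal) (hvS : v ∉ S)
    (hur : GaloisRep.IsUnramifiedAt v (κ.eisensteinTwist (ρ (k + 1)) hm (k + 1))) :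
    letI := IwasawaAlgebra.isLocalRing_quotient_X_pow_add_C p hm
    (κ.eisensteinSelmerStructure ρ t hm S Φ (k + 1) (Sum.inr v)).map
        (ContinuousRep.cohomologyMap (((κ.eisensteinAdicTower ρ t hm ht).ρ (k + 1)).toLocal (Sum.inr v))
          (((κ.eisensteinAdicTower ρ t hm ht).ρ k).toLocal (Sum.inr v))
          ((κ.eisensteinAdicTower ρ t hm ht).red k).toAddMonoidHom continuous_of_discreteTopology
          (fun _ x ↦ (κ.eisensteinAdicTower ρ t hm ht).red_equivariant k _ x) 1) =
      κ.eisensteinSelmerStructure ρ t hm S Φ k (Sum.inr v) := by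
  letI := IwasawaAlgebra.isLocalRing_quotient_X_pow_add_C p hm
  rw [κ.cohomologyMap_toLocal_eq_eisensteinLocalReduce ρ t hm ht k (Sum.inr v),
    κ.eisensteinSelmerStructure_inr_of_not_mem ρ t hm S Φ (k + 1) hv hvS,
    κ.eisensteinSelmerStructure_inr_of_not_mem ρ t hm S Φ k hv hvS]
  exact κ.map_eisensteinLocalReduce_unramifiedSubgroup_eq ρ t hm k (ht k) hur

/-- **`cond_red` for `F_𝔮` with EQUALITY at EVERY finite place**, for the level-`k+1` twist finite and unramified at
the places outside `S ∪ {v ∣ p}` (at `v ∣ p` and `v ∈ S`: D1's saturated towers, `map_red_eisensteinSelmerStructure_eq_of_mem[_finset]`).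
[cite: Howard2004HeegnerKolyvagin, Def. 1.1.3, §1.6 (arXiv p. 12), Def. 2.1.10 and Def. 3.1.2] -/
theorem map_red_eisensteinSelmerStructure_eq_inr (k : ℕ) [Finite (M (k + 1))] (v : HeightOneSpectrum (𝓞 K))
    (hur : ((p : ℕ) : 𝓞 K) ∉ v.asIdeal → v ∉ S →
      GaloisRep.IsUnramifiedAt v (κ.eisensteinTwist (ρ (k + 1)) hm (k + 1))) :
    letI := IwasawaAlgebra.isLocalRing_quotient_X_pow_add_C p hm
    (κ.eisensteinSelmerStructure ρ t hm S Φ (k + 1) (Sum.inr v)).map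
        (ContinuousRep.cohomologyMap (((κ.eisensteinAdicTower ρ t hm ht).ρ (k + 1)).toLocal (Sum.inr v))
          (((κ.eisensteinAdicTower ρ t hm ht).ρ k).toLocal (Sum.inr v))
          ((κ.eisensteinAdicTower ρ t hm ht).red k).toAddMonoidHom continuous_of_discreteTopology
          (fun _ x ↦ (κ.eisensteinAdicTower ρ t hm ht).red_equivariant k _ x) 1) =
      κ.eisensteinSelmerStructure ρ t hm S Φ k (Sum.inr v) := by
  by_cases hv : ((p : ℕ) : 𝓞 K) ∈ v.asIdeal
  · exact κ.map_red_eisensteinSelmerStructure_eq_of_mem ρ t hm ht S Φ k hv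
  by_cases hvS : v ∈ S
  · exact κ.map_red_eisensteinSelmerStructure_eq_of_mem_finset ρ t hm ht S Φ k hv hvS
  · exact κ.map_red_eisensteinSelmerStructure_eq_inr_of_not_mem ρ t hm ht S Φ k hv hvS (hur hv hvS)

/-- **`DVRSetting.SatisfiesH.cond_red` for `F_𝔮` VERBATIM, at every place of a TOTALLY COMPLEX `K`** (e.g. `K`
imaginary quadratic, Howard's setting): the reduction `T_𝔮/p^{k+1} → T_𝔮/p^k` maps the level-`k+1` local condition
ONTO the level-`k` one at every place `v`, provided the levels are finite and the twists unramified outside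
`S ∪ {v ∣ p}` (complex places: `H¹(K_w, ·) = 0`; `v ∣ p`, `v ∈ S`: saturated towers; elsewhere: §2).
[cite: Howard2004HeegnerKolyvagin, Def. 1.1.3, §1.6 (arXiv p. 12, L29–55), H.4 (arXiv p. 7) and Def. 3.1.2] -/
theorem map_red_eisensteinSelmerStructure_eq [NumberField.IsTotallyComplex K] [∀ k, Finite (M k)]
    (hur : ∀ k (v : HeightOneSpectrum (𝓞 K)), ((p : ℕ) : 𝓞 K) ∉ v.asIdeal → v ∉ S →
      GaloisRep.IsUnramifiedAt v (κ.eisensteinTwist (ρ k) hm k))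
    (k : ℕ) (v : NumberField.Place K) :
    letI := IwasawaAlgebra.isLocalRing_quotient_X_pow_add_C p hm
    (κ.eisensteinSelmerStructure ρ t hm S Φ (k + 1) v).map
        (ContinuousRep.cohomologyMap (((κ.eisensteinAdicTower ρ t hm ht).ρ (k + 1)).toLocal v)
          (((κ.eisensteinAdicTower ρ t hm ht).ρ k).toLocal v)
          ((κ.eisensteinAdicTower ρ t hm ht).red k).toAddMonoidHom continuous_of_discreteTopology
          (fun _ x ↦ (κ.eisensteinAdicTower ρ t hm ht).red_equivariant k _ x) 1) =
      κ.eisensteinSelmerStructure ρ t hm S Φ k v := by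
  rcases v with w | v
  · exact κ.map_red_eisensteinSelmerStructure_eq_inl_of_isTotallyComplex ρ t hm ht S Φ k w
  · exact κ.map_red_eisensteinSelmerStructure_eq_inr ρ t hm ht S Φ k v (hur (k + 1) v)

/-- **The same for the SHIFTED tower `eisensteinAdicTowerSucc`** (levels from `1`; D1's `DVRSetting.T`): at every
place of a totally complex `K` the reduction `T_𝔮/p^{k+2} → T_𝔮/p^{k+1}` maps the level-`k+2` condition ONTO the
level-`k+1` one. [cite: Howard2004HeegnerKolyvagin, Def. 1.1.3, §1.6 (arXiv p. 12, L29–55) and Def. 3.1.2] -/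
theorem map_red_eisensteinSelmerStructure_succ_eq [NumberField.IsTotallyComplex K] [∀ k, Finite (M k)]
    (hur : ∀ k (v : HeightOneSpectrum (𝓞 K)), ((p : ℕ) : 𝓞 K) ∉ v.asIdeal → v ∉ S →
      GaloisRep.IsUnramifiedAt v (κ.eisensteinTwist (ρ k) hm k))
    (k : ℕ) (v : NumberField.Place K) :
    letI := IwasawaAlgebra.isLocalRing_quotient_X_pow_add_C p hm
    (κ.eisensteinSelmerStructure ρ t hm S Φ (k + 2) v).map
        (ContinuousRep.cohomologyMap (((κ.eisensteinAdicTowerSucc ρ t hm ht).ρ (k + 1)).toLocal v)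
          (((κ.eisensteinAdicTowerSucc ρ t hm ht).ρ k).toLocal v)
          ((κ.eisensteinAdicTowerSucc ρ t hm ht).red k).toAddMonoidHom continuous_of_discreteTopology
          (fun _ x ↦ (κ.eisensteinAdicTowerSucc ρ t hm ht).red_equivariant k _ x) 1) =
      κ.eisensteinSelmerStructure ρ t hm S Φ (k + 1) v :=
  κ.map_red_eisensteinSelmerStructure_eq ρ t hm ht S Φ hur (k + 1) v

end Literature.NumberTheory.EllipticCurves.ZpExtension

/-! ## §3 The curve: `M_k = E[p^k]` -/

namespace WeierstrassCurve

open Literature.NumberTheory.EllipticCurves Literature.NumberTheory.GaloisRepresentations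
open Literature.NumberTheory.GaloisCohomology.Howard2004

variable {K : Type} [Field K] [NumberField K] (W : WeierstrassCurve K) [W.IsElliptic] {p : ℕ} [hp : Fact p.Prime]
  (κ : ZpExtension K p) {m : ℕ} (hm : 1 ≤ m)
  (t : ∀ k, (W.torsionGaloisModule ((p : ℤ) ^ (k + 1))).toContRepresentation →ⁱL
    (W.torsionGaloisModule ((p : ℤ) ^ k)).toContRepresentation)
  (ht : ∀ k, Function.Surjective (t k))
  (S : Finset (HeightOneSpectrum (𝓞 K)))
  (Φ : ∀ v : HeightOneSpectrum (𝓞 K), ((p : ℕ) : 𝓞 K) ∈ v.asIdeal →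
    ZpExtension.OrdinaryFiltration (fun k ↦ W.torsionGaloisModule ((p : ℤ) ^ k)) t v)

/-- **`cond_red` for Howard's `F_𝔮` ON THE CURVE, at every place and every level** (`K` totally complex, e.g.
imaginary quadratic; `S` a finite set of finite places outside which `E` has good reduction away from `p`): the
reduction `E[p^{k+1}] ⊗ A_{m,k+1} → E[p^k] ⊗ A_{m,k}` of the typed tower `eisensteinAdicTower` maps `F_𝔮` at level
`k + 1` ONTO `F_𝔮` at level `k` — the clause `Howard2004.DVRSetting.SatisfiesH.cond_red`, unconditionally.
[cite: Howard2004HeegnerKolyvagin, Def. 1.1.3, §1.6 (arXiv p. 12, L29–55), §2.2 and Def. 3.1.2]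
[cite: SilvermanAEC2009, Prop. VII.4.1(a)] -/
theorem map_red_eisensteinSelmerStructure_torsionGaloisModule_eq [NumberField.IsTotallyComplex K]
    (hbad : ∀ v : HeightOneSpectrum (𝓞 K), v ∉ S → ((p : ℕ) : 𝓞 K) ∉ v.asIdeal → W.HasGoodReductionAt v)
    (k : ℕ) (v : NumberField.Place K) :
    letI := IwasawaAlgebra.isLocalRing_quotient_X_pow_add_C p hm
    (κ.eisensteinSelmerStructure (fun k ↦ W.torsionGaloisModule ((p : ℤ) ^ k)) t hm S Φ (k + 1) v).map
        (ContinuousRep.cohomologyMap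
          (((κ.eisensteinAdicTower (fun k ↦ W.torsionGaloisModule ((p : ℤ) ^ k)) t hm ht).ρ (k + 1)).toLocal v)
          (((κ.eisensteinAdicTower (fun k ↦ W.torsionGaloisModule ((p : ℤ) ^ k)) t hm ht).ρ k).toLocal v)
          ((κ.eisensteinAdicTower (fun k ↦ W.torsionGaloisModule ((p : ℤ) ^ k)) t hm ht).red k).toAddMonoidHom
          continuous_of_discreteTopology
          (fun _ x ↦ (κ.eisensteinAdicTower (fun k ↦ W.torsionGaloisModule ((p : ℤ) ^ k)) t hm ht).red_equivariant
            k _ x) 1) =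
      κ.eisensteinSelmerStructure (fun k ↦ W.torsionGaloisModule ((p : ℤ) ^ k)) t hm S Φ k v := by
  haveI : ∀ k, Finite (geomTorsion W ((p : ℤ) ^ k)) := fun k ↦
    finite_torsionPoints_holds W (AlgebraicClosure K) (pow_ne_zero _ (Int.natCast_ne_zero.2 hp.out.ne_zero))
  exact κ.map_red_eisensteinSelmerStructure_eq (fun k ↦ W.torsionGaloisModule ((p : ℤ) ^ k)) t hm ht S Φ
    (fun k v hpv hvS ↦ W.isUnramifiedAt_eisensteinTwist_torsionGaloisModule_of_not_mem κ hm hbad hvS hpv k) k v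

/-- **`cond_red` for Howard's `F_𝔮` ON THE CURVE along the SHIFTED tower `eisensteinAdicTowerSucc`** (levels
`E[p^{k+1}] ⊗ A_{m,k+1}`, D1's `DVRSetting.T`), at every place and every level, `K` totally complex.
[cite: Howard2004HeegnerKolyvagin, Def. 1.1.3, §1.6 (arXiv p. 12, L29–55), §2.2 and Def. 3.1.2]
[cite: SilvermanAEC2009, Prop. VII.4.1(a)] -/
theorem map_red_eisensteinSelmerStructure_torsionGaloisModule_succ_eq [NumberField.IsTotallyComplex K]
    (hbad : ∀ v : HeightOneSpectrum (𝓞 K), v ∉ S → ((p : ℕ) : 𝓞 K) ∉ v.asIdeal → W.HasGoodReductionAt v)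
    (k : ℕ) (v : NumberField.Place K) :
    letI := IwasawaAlgebra.isLocalRing_quotient_X_pow_add_C p hm
    (κ.eisensteinSelmerStructure (fun k ↦ W.torsionGaloisModule ((p : ℤ) ^ k)) t hm S Φ (k + 2) v).map
        (ContinuousRep.cohomologyMap
          (((κ.eisensteinAdicTowerSucc (fun k ↦ W.torsionGaloisModule ((p : ℤ) ^ k)) t hm ht).ρ (k + 1)).toLocal v)
          (((κ.eisensteinAdicTowerSucc (fun k ↦ W.torsionGaloisModule ((p : ℤ) ^ k)) t hm ht).ρ k).toLocal v)
          ((κ.eisensteinAdicTowerSucc (fun k ↦ W.torsionGaloisModule ((p : ℤ) ^ k)) t hm ht).red k).toAddMonoidHom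
          continuous_of_discreteTopology
          (fun _ x ↦ (κ.eisensteinAdicTowerSucc (fun k ↦ W.torsionGaloisModule ((p : ℤ) ^ k)) t hm ht).red_equivariant
            k _ x) 1) =
      κ.eisensteinSelmerStructure (fun k ↦ W.torsionGaloisModule ((p : ℤ) ^ k)) t hm S Φ (k + 1) v :=
  W.map_red_eisensteinSelmerStructure_torsionGaloisModule_eq κ hm t ht S Φ hbad (k + 1) v

end WeierstrassCurve

end
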